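import Mathlib.MeasureTheory.Integral.IntervalIntegral.Basic
import Mathlib.MeasureTheory.Integral.Bochner.ContinuousLinearMap
import Mathlib.Analysis.SpecialFunctions.Trigonometric.Arctan
import Literature.NumberTheory.LFunctions.RiemannXi
import Literature.NumberTheory.LFunctions.RiemannXiProofs
import HarnessLib

/-!
# The integral of Riemann's `ξ` (Lagarias–Montague 2011): the segment primitive and named facts

Topic `Literature/NumberTheory/LFunctions` (Riemann's `ξ`, companion of `RiemannXi.lean`).

Lagarias–Montague, *The integral of the Riemann ξ-function*, Comment. Math. Univ. St. Pauli 60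
(2011) 143–169 (arXiv:1106.4348), study the entire function
`ξ^{(-1)}(s) := ∫_{1/2}^{s} ξ(w) dw` (their eq. (1.3)) and `Ξ^{(-1)}(z) := −i ξ^{(-1)}(1/2 + iz)`.
This file

* DEFINES `Literature.NumberTheory.LFunctions.riemannXiPrimitive s` as the SEGMENT integral
  `(∫₀¹ ξ(1/2 + u (s − 1/2)) du) · (s − 1/2)` — literally the expression inlined by the statements
  of route `Summits/RiemannHypothesis/RiemannHypothesis/Theses/NodalHairpin.lean` (so those unfold
  to it by `rfl`); since `ξ` is entire this is `∫_{1/2}^{s} ξ` along any path;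
* PROVES the symmetries `ξ^{(-1)}(1 − s) = −ξ^{(-1)}(s)` [LM2011 eq. (1.4)],
  `ξ^{(-1)}(conj s) = conj ξ^{(-1)}(s)`, hence `ξ^{(-1)}(1 − conj s) = −conj ξ^{(-1)}(s)` and
  `Re ξ^{(-1)} = 0` on the critical line [LM2011 Lemma 3.2 (2): `Ξ^{(-1)}` is real on the real
  axis] — this is the statement `NodalOddSymmetry` of the route, now a theorem
  (`riemannXiPrimitive_one_sub_conj`);
* VENDORS as named facts (nothing asserted; users take `(h : <name>)`):
  - `norm_riemannXi_le_of_mem_strip_LM` — LM2011 Lemma 3.3 (1): on `1/2 ≤ Re s ≤ 2`,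
    `|ξ(s)| ≤ C₁ e^{−π|t|/4} (|t| + 1)^{5/2}` (the vertical decay used by `NodalDecay`,
    `NodalProper` of the route);
  - `norm_riemannXi_two_sided_LM` — LM2011 Lemma 3.3 (2): for `σ ≥ 2` and all real `t`,
    `F(σ,t)(1 − C₂(1/|σ+it| + 2^{−σ})) ≤ |ξ(σ+it)| ≤ F(σ,t)(1 + C₃(1/|σ+it| + 2^{−σ}))` with the
    size model `F(σ,t) = √π (2πe)^{−σ/2} (σ²+t²)^{(σ+3)/4} exp(−(t/2) arctan(t/σ))` (eq. (3.6))
    (far-field size of `ξ`, for `NodalLadderFar`);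
  - `tendsto_riemannXiPrimitive_criticalLine_LM` — LM2011 Thm. 2.1 (1) (at `λ = 0`):
    `ξ^{(-1)}(1/2 + it) → i A₀` as `t → +∞`, `A₀ = π Φ(0) = π Σ_{n≥1}(4π²n⁴ − 6πn²)e^{−πn²} ≈ 2.80668`
    (the constant `c₀ = ∫₀^∞ Ξ` in the far-field representation `ξ^{(-1)}(σ+it) = i c₀ − i∫_t^∞ ξ(σ+iτ)dτ`
    used by `NodalLadderFar` / `NodalDecay`).

Deliberately NOT here: Thm. 2.1 (2) (finitely many real zeros of `Ξ_λ^{(-1)}`), Thm. 2.2 (value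
distribution `|σ| = (π/2)|t|/log|t| + O(|t|/log²|t|)` of the `α`-points), Wintner's positivity
`Ξ^{(-1)}(t) > 0` for `t > 0`, and the de Bruijn–Newman analogue `Λ^{(-1)} = +∞`.

## References

* J. C. Lagarias, D. Montague, *The integral of the Riemann ξ-function*, Comment. Math. Univ.
  St. Pauli 60 (2011), no. 1-2, 143–169; arXiv:1106.4348 — eq. (1.3), (1.4), Thm. 2.1, Lemma 3.2,
  Lemma 3.3, eq. (3.6). [key `LagariasMontague2011`]
* E. C. Titchmarsh, *The Theory of the Riemann Zeta-Function*, 2nd ed., §2.12 (inputs of Lemma 3.3).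
-/

noncomputable section

open Complex Filter MeasureTheory intervalIntegral
open scoped Real Topology ComplexConjugate

namespace Literature.NumberTheory.LFunctions

/-! ## The segment primitive `ξ^{(-1)}` -/

/-- **The integral of the `ξ`-function** `ξ^{(-1)}(s) := ∫_{1/2}^{s} ξ(w) dw`
(Lagarias–Montague 2011, eq. (1.3)), realised as the integral along the segment from `1/2` to `s`:
`(∫₀¹ ξ(1/2 + u(s − 1/2)) du) · (s − 1/2)`. Because `ξ` is entire the value does not depend on the
path; this literal form is the one inlined in the `NodalHairpin` route statements.
[cite: LagariasMontague2011, eq. (1.3)] -/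
def riemannXiPrimitive (s : ℂ) : ℂ :=
  (∫ u in (0:ℝ)..1, riemannXi (1 / 2 + (u : ℂ) * (s - 1 / 2))) * (s - 1 / 2)

/-- `ξ^{(-1)}(1/2) = 0`. [cite: LagariasMontague2011, §1.1 (Taylor expansion at 1/2)] -/
theorem riemannXiPrimitive_one_half : riemannXiPrimitive (1 / 2) = 0 := by
  simp [riemannXiPrimitive]

/-- **Functional equation** `ξ^{(-1)}(1 − s) = −ξ^{(-1)}(s)` (from `ξ(1 − w) = ξ(w)`).
[cite: LagariasMontague2011, eq. (1.4)] -/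
theorem riemannXiPrimitive_one_sub (s : ℂ) :
    riemannXiPrimitive (1 - s) = -riemannXiPrimitive s := by
  unfold riemannXiPrimitive
  have h : ∀ u : ℝ, riemannXi (1 / 2 + (u : ℂ) * (1 - s - 1 / 2)) =
      riemannXi (1 / 2 + (u : ℂ) * (s - 1 / 2)) := fun u => by
    rw [← riemannXi_one_sub (1 / 2 + (u : ℂ) * (s - 1 / 2))]
    congr 1
    ring
  simp_rw [h]
  ring

/-- **Reflection** `ξ^{(-1)}(conj s) = conj ξ^{(-1)}(s)` (from `ξ(conj w) = conj ξ(w)`,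
`riemannXi_conj_holds`). [folklore] -/
theorem riemannXiPrimitive_conj (s : ℂ) :
    riemannXiPrimitive (conj s) = conj (riemannXiPrimitive s) := by
  unfold riemannXiPrimitive
  have h : ∀ u : ℝ, riemannXi (1 / 2 + (u : ℂ) * (conj s - 1 / 2)) =
      conj (riemannXi (1 / 2 + (u : ℂ) * (s - 1 / 2))) := fun u => by
    rw [← riemannXi_conj_holds (1 / 2 + (u : ℂ) * (s - 1 / 2))]
    congr 1
    simp only [map_add, map_mul, map_sub, map_div₀, map_one, map_ofNat, Complex.conj_ofReal]
  simp_rw [h]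
  rw [intervalIntegral.integral_of_le zero_le_one, intervalIntegral.integral_of_le zero_le_one,
    integral_conj, map_mul]
  congr 1
  simp only [map_sub, map_div₀, map_one, map_ofNat]

/-- **Oddness across the critical line** `ξ^{(-1)}(1 − conj s) = −conj ξ^{(-1)}(s)`: the
statement `NodalOddSymmetry` of route `NodalHairpin` (so `Re ξ^{(-1)}` is odd under reflection in
`Re s = 1/2`). [cite: LagariasMontague2011, Lemma 3.2 (2)] -/
theorem riemannXiPrimitive_one_sub_conj (s : ℂ) :
    riemannXiPrimitive (1 - conj s) = -conj (riemannXiPrimitive s) := by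
  rw [riemannXiPrimitive_one_sub, riemannXiPrimitive_conj]

/-- `Re ξ^{(-1)}(1/2 + it) = 0`: `ξ^{(-1)}` is purely imaginary on the critical line, i.e.
`Ξ^{(-1)}(t) = −i ξ^{(-1)}(1/2 + it)` is real for real `t`. [cite: LagariasMontague2011, Lemma 3.2 (2)] -/
theorem re_riemannXiPrimitive_criticalLine (t : ℝ) :
    (riemannXiPrimitive (1 / 2 + t * I)).re = 0 := by
  have hfix : 1 - conj ((1 / 2 : ℂ) + t * I) = 1 / 2 + t * I := by
    apply Complex.ext <;> norm_num
  have h := riemannXiPrimitive_one_sub_conj (1 / 2 + t * I)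
  rw [hfix] at h
  have hre := congrArg Complex.re h
  simp only [Complex.neg_re, Complex.conj_re] at hre
  linarith

/-! ## Named facts from Lagarias–Montague 2011 -/

/-- NAMED FACT (**Lagarias–Montague 2011, Lemma 3.3 (1)**): there is a positive constant `C₁` such
that for `1/2 ≤ Re s ≤ 2`, `|ξ(s)| ≤ C₁ e^{−π|t|/4} (|t| + 1)^{5/2}` (`t = Im s`). Printed proof:
`|½s(s−1)| = O(|t|²)`, `|π^{−s/2}| = O(1)`, `|Γ(s/2)| = O(e^{−π|t|/4})`, convexity
`|ζ(s)| ≤ C|t|^{1/2}` for `σ ≥ 1/2`, `|t| ≥ 2`. Grounds the vertical decay inputs of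
`Summit.RiemannHypothesis.RiemannHypothesis.Theses.NodalHairpin.NodalDecay` / `.NodalProper`.
Users take `(h : norm_riemannXi_le_of_mem_strip_LM)`. [cite: LagariasMontague2011, Lemma 3.3 (1)] -/
def norm_riemannXi_le_of_mem_strip_LM : Prop :=
  ∃ C₁ : ℝ, 0 < C₁ ∧ ∀ s : ℂ, 1 / 2 ≤ s.re → s.re ≤ 2 →
    ‖riemannXi s‖ ≤ C₁ * Real.exp (-(π / 4) * |s.im|) * (|s.im| + 1) ^ (5 / 2 : ℝ)

/-- The size model `F(σ, t) := √π (2πe)^{−σ/2} (σ² + t²)^{(σ+3)/4} exp(−(t/2) arctan(t/σ))` of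
Lagarias–Montague (defined for `σ ≥ 0`, `t` real; it is even in `t`).
[cite: LagariasMontague2011, eq. (3.6)] -/
def LagariasMontague.sizeModel (σ t : ℝ) : ℝ :=
  Real.sqrt π * (2 * π * Real.exp 1) ^ (-(σ / 2)) * (σ ^ 2 + t ^ 2) ^ ((σ + 3) / 4) *
    Real.exp (-(t / 2) * Real.arctan (t / σ))

/-- NAMED FACT (**Lagarias–Montague 2011, Lemma 3.3 (2)**): there are positive constants `C₂, C₃`
such that for `s = σ + it` with `σ ≥ 2` and all real `t`,
`F(σ,t)(1 − C₂(1/|σ+it| + 2^{−σ})) ≤ |ξ(s)| ≤ F(σ,t)(1 + C₃(1/|σ+it| + 2^{−σ}))`, with `F` the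
size model `LagariasMontague.sizeModel` (Stirling for `Γ(s/2)` and `|ζ(s)| = 1 + O(2^{−σ})`).
Far-field size of `ξ`, for `Summit.RiemannHypothesis.RiemannHypothesis.Theses.NodalHairpin.NodalLadderFar`.
Users take `(h : norm_riemannXi_two_sided_LM)`. [cite: LagariasMontague2011, Lemma 3.3 (2)] -/
def norm_riemannXi_two_sided_LM : Prop :=
  ∃ C₂ C₃ : ℝ, 0 < C₂ ∧ 0 < C₃ ∧ ∀ σ t : ℝ, 2 ≤ σ →
    LagariasMontague.sizeModel σ t * (1 - C₂ * (1 / ‖(σ : ℂ) + t * I‖ + (2 : ℝ) ^ (-σ))) ≤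
        ‖riemannXi (σ + t * I)‖ ∧
      ‖riemannXi (σ + t * I)‖ ≤
        LagariasMontague.sizeModel σ t * (1 + C₃ * (1 / ‖(σ : ℂ) + t * I‖ + (2 : ℝ) ^ (-σ)))

/-- The constant `A₀ := π Φ(0) = π Σ_{n ≥ 1} (4π²n⁴ − 6πn²) e^{−πn²} ≈ 2.80668` of
Lagarias–Montague (`Φ(0) ≈ 0.89339`, `Φ` the kernel of Riemann's cosine integral for `Ξ`).
[cite: LagariasMontague2011, Thm. 2.1 (1)] -/
def LagariasMontague.A₀ : ℝ :=
  π * ∑' n : ℕ, (4 * π ^ 2 * ((n : ℝ) + 1) ^ 4 - 6 * π * ((n : ℝ) + 1) ^ 2) *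
    Real.exp (-(π * ((n : ℝ) + 1) ^ 2))

/-- NAMED FACT (**Lagarias–Montague 2011, Thm. 2.1 (1)**, case `λ = 0`): `lim_{t → ∞} Ξ^{(-1)}(t) = A₀`
with `A₀ = π Φ(0) ≈ 2.80668` a nonzero constant; since `Ξ^{(-1)}(t) = −i ξ^{(-1)}(1/2 + it)` this
reads `ξ^{(-1)}(1/2 + it) → i A₀` as `t → +∞` (and `→ −iA₀` as `t → −∞` by oddness). `A₀ = ∫₀^∞ Ξ`
is the constant `c₀` of the far-field representation used by `…NodalHairpin.NodalLadderFar`.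
Users take `(h : tendsto_riemannXiPrimitive_criticalLine_LM)`. [cite: LagariasMontague2011, Thm. 2.1 (1)] -/
def tendsto_riemannXiPrimitive_criticalLine_LM : Prop :=
  LagariasMontague.A₀ ≠ 0 ∧
    Tendsto (fun t : ℝ => riemannXiPrimitive (1 / 2 + t * I)) atTop
      (𝓝 ((LagariasMontague.A₀ : ℂ) * I))

end Literature.NumberTheory.LFunctions
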